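import Literature.NumberTheory.Transcendental.MultipleZetaHoffmanRelationProofs
import Literature.NumberTheory.Transcendental.MultipleZetaHoffmanRelationGeneralProofs
import HarnessLib

/-!
# Hoffman's relation among multiple zeta values (Hoffman 1992, Theorem 5.1) — named fact

M. E. Hoffman, *Multiple harmonic series*, Pacific J. Math. 152 (1992) 275–290, Theorem 5.1
(p. 286), printed statement: "Let `i₁, i₂, …, i_k` be any sequence of positive integers with
`i₁ > 1`. Then
`Σ_{1 ≤ l ≤ k} A(i₁, …, i_{l-1}, i_l + 1, i_{l+1}, …, i_k)
   = Σ_{1 ≤ l ≤ k, i_l ≥ 2} Σ_{j=0}^{i_l - 2} A(i₁, …, i_{l-1}, i_l − j, j + 1, i_{l+1}, …, i_k)`",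
where `A(i₁,…,i_k) = Σ_{n₁ > n₂ > ⋯ > n_k ≥ 1} n₁^{-i₁} ⋯ n_k^{-i_k}` (Hoffman's §1) is exactly the
tree's `multipleZeta [i₁,…,i_k]` (decreasing convention, admissible iff `i₁ ≥ 2`,
`MZV.IsAdmissible`). Proof in print: multiply series and a partial-fractions identity (pp. 286–287);
it is the `v = y₁` slice of the regularised double shuffle relations (Ihara–Kaneko–Zagier 2006)
and Hoffman's "derivation relation".

Vendored AS PRINTED as the named fact `hoffman_relation` (CONVENTIONS §4), in the indexing of the
consumer: positions `l : Fin s.length` (0-based), inner sum over `j ∈ Finset.range (s.get l - 1)`,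
i.e. `j = 0, …, s_l − 2` (empty when `s_l = 1`, which is Hoffman's side condition `i_l ≥ 2`); the
modified index lists are built with `List.take`/`List.drop`. Every list occurring is admissible when
`s` is (the first entry only grows on the left, and on the right `s₀ − j ≥ 2`).

In the tree already (PROVED instances, not the general statement): `multipleZeta_two_one_one_eq_add`
(`s = (2,1)`: `ζ(2,1,1) = ζ(3,1) + ζ(2,2)`, MultipleZetaHoffmanRelationProofs.lean) and the depth-two
sum formula `multipleZeta_sum_formula_depth_two` (contains `s = (n)`: `ζ(n+1) = Σ_j ζ(n−j, j+1)`).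
The sanity theorem `hoffman_relation_instance_two_one` below proves the fact's `s = [2,1]` instance
from the former, confirming the indexing conventions.

This fact is the real-value shadow of route `KontsevichZagierPeriods/CoactionDevissage`, crux
`Summit.KontsevichZagierPeriods.KontsevichZagierPeriods.Theses.CoactionDevissage.HoffmanRegularisation`
(which asserts the same family as KZ-MOVE equivalences of simplex representations — new, not in
print); by soundness `KZ.relations_le_ker_eval` the crux implies this fact instance-wise, and a
refuter's separating invariant must be non-evaluative. What is NOT here: the regularised double
shuffle family in general (IKZ 2006), Hoffman's 1997 algebraic reformulation, motivic versions.
-/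

noncomputable section

namespace Literature.NumberTheory.Transcendental

open scoped BigOperators

/-- **Hoffman's relation** (Hoffman 1992, Theorem 5.1, p. 286): for every admissible index
`s = (s₁,…,s_k)` (decreasing convention of `multipleZeta`, `s₁ ≥ 2`, all `sᵢ ≥ 1`),
`Σ_l ζ(s₁,…,s_l + 1,…,s_k) = Σ_l Σ_{j=0}^{s_l−2} ζ(s₁,…,s_{l−1}, s_l − j, j + 1, s_{l+1},…,s_k)`.
Instances: `s = (2)`: `ζ(3) = ζ(2,1)`; `s = (3)`: `ζ(4) = ζ(3,1) + ζ(2,2)`; `s = (2,1)`: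
`ζ(3,1) + ζ(2,2) = ζ(2,1,1)` (tree: `multipleZeta_two_one_one_eq_add`). Grounds the real-value
shadow of `Summit.KontsevichZagierPeriods.KontsevichZagierPeriods.Theses.CoactionDevissage.HoffmanRegularisation`.
[cite: Hoffman1992, Theorem 5.1] -/
def hoffman_relation : Prop :=
  ∀ s : List ℕ, MZV.IsAdmissible s →
    (∑ l : Fin s.length, multipleZeta (s.take l.1 ++ [s.get l + 1] ++ s.drop (l.1 + 1))) =
      ∑ l : Fin s.length, ∑ j ∈ Finset.range (s.get l - 1),
        multipleZeta (s.take l.1 ++ [s.get l - j, j + 1] ++ s.drop (l.1 + 1))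

/-- Sanity / indexing check: the `s = [2,1]` instance of `hoffman_relation`, written out exactly as
the fact's body specialises, IS the proved tree theorem `ζ(2,1,1) = ζ(3,1) + ζ(2,2)`
(`multipleZeta_two_one_one_eq_add`; Hoffman 1992, Theorem 5.1 applied to `(2,1)`, §5 p. 288).
[cite: Hoffman1992, Theorem 5.1] -/
theorem hoffman_relation_instance_two_one :
    (∑ l : Fin [2, 1].length, multipleZeta ([2, 1].take l.1 ++ [[2, 1].get l + 1] ++ [2, 1].drop (l.1 + 1))) =
      ∑ l : Fin [2, 1].length, ∑ j ∈ Finset.range ([2, 1].get l - 1),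
        multipleZeta ([2, 1].take l.1 ++ [[2, 1].get l - j, j + 1] ++ [2, 1].drop (l.1 + 1)) := by
  simp [Fin.sum_univ_two, multipleZeta_two_one_one_eq_add]

/-- **Discharge of `hoffman_relation`** (Hoffman 1992, Theorem 5.1, p. 286, proof pp. 286–288):
Hoffman's relation holds for every admissible index — the general theorem
`multipleZeta_hoffman_relation` of `MultipleZetaHoffmanRelationGeneralProofs.lean`, which follows the
printed proof ((1) harmonic-factor stuffle, (2) telescoping, iterated partial fractions with the swap
of consecutive gaps, cancellation of the finite inserted-`1` sum). Users holding
`(h : hoffman_relation)` are fed `hoffman_relation_holds`. [cite: Hoffman1992, Theorem 5.1] -/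
theorem hoffman_relation_holds : hoffman_relation := fun _ hs =>
  multipleZeta_hoffman_relation hs

end Literature.NumberTheory.Transcendental
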